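import Summits.BirchSwinnertonDyer.BirchSwinnertonDyer.Theorems.ByReductionTypeAtTwoMultTowerNS2CoinvariantsOdd
import HarnessLib

/-!
# Route `ByReductionTypeAtTwo`, crux `MultUpperHalfAtTwo` (item stmt-BirchSwinnertonDyer-19922), TOWER road, the
# «ONE BIT AT A NON-SPLIT 2» rows: KERNEL BRICK 16d — at most TWO `2`-torsion coinvariant classes of the twisted Tate
# module over the local cyclotomic `ℤ₂`-tower (scope memo S3–S6 assembled: the «no three classes» form)

HONEST FRAMING (cell `bsd-2adic`, run/shared/lean/pub/bsd-2adic/, seat `bsd-2adic-tower-1` GEN 9, HUMAN RULINGS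
D-0036 / D-0054 / D-0074): TOOL theorems only (no definition, no named fact, no `sorry`); closes nothing by itself;
nothing booked; BSD is not proved by any of this. Module M6 of the KERNELISATION of the MEMO binder
`MultTowerNS2.localTowerKerTwoTorsion_le_two_nonsplitTwo_of_tateUnit` (scope memo HOME/tower/SCOPE-hNS2one-kernel-GEN8.md).
Setting as in BRICKs 15/16a–c. Write `T = {x ∈ (K̄^{H_∞ ∩ Stab(t)})ˣ : τ₀x·x ∈ q^ℤ}` (the twisted Tate module modulo
nothing), `B = q^ℤ · (g−1)T` (the classes trivial in the coinvariants `T/q^ℤ/(g−1)`), `N_σ(f) = f · τ₀f`.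

* `mem_B_div_of_norm_rel` — **C7**: two coboundaries `x = gy/y`, `x' = gy'/y'` whose norms differ by
  `q^ε · N_σ(f₀)`, `f₀ ∈ K̄^{H_n ∩ Stab(t)}`, have `x/x' ∈ B`;
* `mem_B_of_even_of_not_caseA` — **C6**: if NO `f₀ ∈ K̄^{H_n ∩ Stab(t)}` has `N_σ(f₀) = q` (case B) and `F_nˣ` has at most
  two classes modulo `N_σ` (the CLASS FIELD AXIOM for the quadratic `K̄^{H_n ∩ Stab(t)}/F_n`, hypothesis `hN2`), then every
  `x ∈ T` of even exponent with `x² ∈ B` lies in `B` (C3 + the axiom applied to `{v, 1, q}`);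
* `exists_div_mem_B_of_three` — **MAIN**: among any three `x₁, x₂, x₃ ∈ T` with `x_i² ∈ B`, two are congruent modulo
  `B` (case A: all exponents even by BRICK 16c, then C3 + axiom on the three norms + C7; case B: two exponents of the
  same parity, C6). Consequence (assembly file): `#(E(ℚ_{2,∞})/(g−1))[2] ≤ 2`, whence hNS2one by BRICK 11.

References: R. Greenberg, LNM 1716 §3 (pp. 87–93); J. Neukirch, *ANT* V (1.1); scope memo S3–S6.
-/

set_option autoImplicit false
-- the Theorems namespace of this sub repeats the summit name by design (D-0017 nested layout: Summit.<S>.<Sub>)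
set_option linter.dupNamespace false

noncomputable section

open scoped Classical IntermediateField

namespace Summit.BirchSwinnertonDyer.BirchSwinnertonDyer.Theorems.MultTowerNS2

open NumberField IsDedekindDomain Field PadicInt Literature.NumberTheory.EllipticCurves
  Literature.NumberTheory.GaloisRepresentations

variable {κ : ZpExtension ℚ 2}

/-- **C7: two coboundaries with norms in the same `N_σ`-class modulo `q^ℤ` are congruent modulo `B`.** For `y, y'` non-zero in
`K̄^{H_∞ ∩ Stab(t)}` and `f₀ ≠ 0` in `K̄^{H_n ∩ Stab(t)}` (so `g f₀ = f₀`) with `y·τ₀y = Q^ε · (f₀·τ₀f₀) · (y'·τ₀y')`: the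
element `z = y/(y' f₀)` lies in `T` with `τ₀z · z = Q^ε` and `(gy/y)/(gy'/y') = gz/z`. [cite: GreenbergLNM1716, §3 (pp. 87–89)] -/
theorem div_coboundary_eq_of_norm_rel (v : HeightOneSpectrum (𝓞 ℚ)) (n : ℕ)
    {g : absoluteGaloisGroup (v.adicCompletion ℚ)} (hgn : g ∈ localSubgroup (κ.layerSubgroup n) (v.adicCompletion ℚ))
    {t : AlgebraicClosure (v.adicCompletion ℚ)} (hgt : g • t = t)
    {τ₀ : absoluteGaloisGroup (v.adicCompletion ℚ)} {Q : AlgebraicClosure (v.adicCompletion ℚ)} {ε : ℤ}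
    {y y' f₀ : AlgebraicClosure (v.adicCompletion ℚ)} (hy0 : y ≠ 0) (hy'0 : y' ≠ 0) (hf₀0 : f₀ ≠ 0)
    (hyL : ∀ h ∈ localSubgroup κ.kerSubgroup (v.adicCompletion ℚ), h • t = t → h • y = y)
    (hy'L : ∀ h ∈ localSubgroup κ.kerSubgroup (v.adicCompletion ℚ), h • t = t → h • y' = y')
    (hf₀M : ∀ h ∈ localSubgroup (κ.layerSubgroup n) (v.adicCompletion ℚ), h • t = t → h • f₀ = f₀)
    (hrel : y * τ₀ • y = Q ^ ε * (f₀ * τ₀ • f₀) * (y' * τ₀ • y')) :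
    (y / (y' * f₀)) ≠ 0 ∧
      (∀ h ∈ localSubgroup κ.kerSubgroup (v.adicCompletion ℚ), h • t = t → h • (y / (y' * f₀)) = y / (y' * f₀)) ∧
      τ₀ • (y / (y' * f₀)) * (y / (y' * f₀)) = Q ^ ε ∧
      (g • y / y) / (g • y' / y') = g • (y / (y' * f₀)) / (y / (y' * f₀)) := by
  have hile : localSubgroup κ.kerSubgroup (v.adicCompletion ℚ) ≤ localSubgroup (κ.layerSubgroup n) (v.adicCompletion ℚ) :=
    fun τ hτ ↦ by
      rw [mem_localSubgroup_iff] at hτ ⊢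
      exact κ.kerSubgroup_le_layerSubgroup n hτ
  have hgf₀ : g • f₀ = f₀ := hf₀M g hgn hgt
  have hτy'0 : τ₀ • y' ≠ 0 := (smul_ne_zero_iff_ne τ₀).mpr hy'0
  have hτf₀0 : τ₀ • f₀ ≠ 0 := (smul_ne_zero_iff_ne τ₀).mpr hf₀0
  have hgy'0 : g • y' ≠ 0 := (smul_ne_zero_iff_ne g).mpr hy'0
  refine ⟨div_ne_zero hy0 (mul_ne_zero hy'0 hf₀0), fun h hh hht ↦ ?_, ?_, ?_⟩
  · rw [smul_div₀', smul_mul', hyL h hh hht, hy'L h hh hht, hf₀M h (hile hh) hht]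
  · rw [smul_div₀', smul_mul']
    field_simp
    linear_combination hrel
  · rw [smul_div₀', smul_mul', hgf₀]
    field_simp

/-- **Normalising an element of even exponent to the unit circle.** If `τ₀x·x = Q^{2c}` then `x' = x·Q^{-c}` is still
fixed by `H_∞ ∩ Stab(t)`, satisfies `τ₀x'·x' = 1`, and `x'^2 = Q^{j-2c}·gz/z` whenever `x^2 = Q^j·gz/z`.
[cite: GreenbergLNM1716, §3 (pp. 87–89)] -/
theorem smul_mul_zpow_inv (v : HeightOneSpectrum (𝓞 ℚ)) {g τ₀ : absoluteGaloisGroup (v.adicCompletion ℚ)}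
    {t Q x z : AlgebraicClosure (v.adicCompletion ℚ)}
    (hQfix : ∀ σ : absoluteGaloisGroup (v.adicCompletion ℚ), σ • Q = Q) (hQ0 : Q ≠ 0)
    (hxL : ∀ h ∈ localSubgroup κ.kerSubgroup (v.adicCompletion ℚ), h • t = t → h • x = x)
    {c : ℤ} (hxc : τ₀ • x * x = Q ^ (2 * c)) {j : ℤ} (hx2 : x ^ 2 = Q ^ j * (g • z / z)) :
    (∀ h ∈ localSubgroup κ.kerSubgroup (v.adicCompletion ℚ), h • t = t → h • (x * (Q ^ c)⁻¹) = x * (Q ^ c)⁻¹) ∧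
      τ₀ • (x * (Q ^ c)⁻¹) * (x * (Q ^ c)⁻¹) = 1 ∧ (x * (Q ^ c)⁻¹) ^ 2 = Q ^ (j - 2 * c) * (g • z / z) := by
  have hQc : Q ^ c ≠ 0 := zpow_ne_zero _ hQ0
  refine ⟨fun h hh hht ↦ by rw [smul_mul', smul_inv'', smul_zpow₀', hQfix, hxL h hh hht], ?_, ?_⟩
  · rw [smul_mul', smul_inv'', smul_zpow₀', hQfix]
    field_simp
    rw [hxc, two_mul, zpow_add₀ hQ0]
    exact (sq _).symm
  · rw [mul_pow, hx2, inv_pow, ← zpow_natCast (Q ^ c), ← zpow_mul, zpow_sub₀ hQ0]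
    push_cast
    ring

/-- **C6: in CASE B every `2`-torsion class of even exponent is trivial.** Hypotheses: no `f₀ ∈ K̄^{H_n ∩ Stab(t)}` has
`f₀·τ₀f₀ = Q` (case B); `hN2`: among any three non-zero `H_n`-invariant elements two differ by a norm `f₀·τ₀f₀`,
`f₀ ∈ K̄^{H_n ∩ Stab(t)}` (the class field axiom for the unramified quadratic layer); `x ∈ T` with `τ₀x·x = Q^{2c}` and
`x² = Q^j · gz/z`, `z ∈ T`. Then `x = Q^{c'} · gw/w` for some `w ∈ T`. [cite: GreenbergLNM1716, §3 (pp. 87–93)] -/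
theorem exists_eq_zpow_mul_coboundary_of_even (v : HeightOneSpectrum (𝓞 ℚ)) (n : ℕ)
    {g : absoluteGaloisGroup (v.adicCompletion ℚ)} {ug : ℤ_[2]ˣ}
    (hug : ((κ (resGal (K := ℚ) (v.adicCompletion ℚ) g)).toAdd : ℤ_[2]) = 2 ^ n * (ug : ℤ_[2]))
    (hgn : g ∈ localSubgroup (κ.layerSubgroup n) (v.adicCompletion ℚ))
    {t : AlgebraicClosure (v.adicCompletion ℚ)}
    (ht : ∀ σ : absoluteGaloisGroup (v.adicCompletion ℚ), σ • t = t ∨ σ • t = -t) (hgt : g • t = t)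
    {τ₀ : absoluteGaloisGroup (v.adicCompletion ℚ)} (hτ₀ : τ₀ ∈ localSubgroup κ.kerSubgroup (v.adicCompletion ℚ))
    (hτ₀t : τ₀ • t = -t) {Q : AlgebraicClosure (v.adicCompletion ℚ)}
    (hQfix : ∀ σ : absoluteGaloisGroup (v.adicCompletion ℚ), σ • Q = Q) (hQ0 : Q ≠ 0)
    (hQtor : ∀ j : ℤ, Q ^ j = 1 → j = 0)
    (hB : ∀ f₀ : AlgebraicClosure (v.adicCompletion ℚ), f₀ ≠ 0 →
      (∀ h ∈ localSubgroup (κ.layerSubgroup n) (v.adicCompletion ℚ), h • t = t → h • f₀ = f₀) → τ₀ • f₀ * f₀ ≠ Q)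
    (hN2 : ∀ c₁ c₂ c₃ : AlgebraicClosure (v.adicCompletion ℚ), c₁ ≠ 0 → c₂ ≠ 0 → c₃ ≠ 0 →
      (∀ h ∈ localSubgroup (κ.layerSubgroup n) (v.adicCompletion ℚ), h • c₁ = c₁) →
      (∀ h ∈ localSubgroup (κ.layerSubgroup n) (v.adicCompletion ℚ), h • c₂ = c₂) →
      (∀ h ∈ localSubgroup (κ.layerSubgroup n) (v.adicCompletion ℚ), h • c₃ = c₃) →
      ∃ f₀ : AlgebraicClosure (v.adicCompletion ℚ), f₀ ≠ 0 ∧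
        (∀ h ∈ localSubgroup (κ.layerSubgroup n) (v.adicCompletion ℚ), h • t = t → h • f₀ = f₀) ∧
        (c₁ = f₀ * τ₀ • f₀ * c₂ ∨ c₁ = f₀ * τ₀ • f₀ * c₃ ∨ c₂ = f₀ * τ₀ • f₀ * c₃))
    {x : AlgebraicClosure (v.adicCompletion ℚ)} (hx0 : x ≠ 0)
    (hxL : ∀ h ∈ localSubgroup κ.kerSubgroup (v.adicCompletion ℚ), h • t = t → h • x = x)
    {c : ℤ} (hxc : τ₀ • x * x = Q ^ (2 * c))
    {j : ℤ} {z : AlgebraicClosure (v.adicCompletion ℚ)} (hz0 : z ≠ 0)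
    (hzL : ∀ h ∈ localSubgroup κ.kerSubgroup (v.adicCompletion ℚ), h • t = t → h • z = z) {j' : ℤ}
    (hzj : τ₀ • z * z = Q ^ j') (hx2 : x ^ 2 = Q ^ j * (g • z / z)) :
    ∃ (c' : ℤ) (w : AlgebraicClosure (v.adicCompletion ℚ)), w ≠ 0 ∧
      (∀ h ∈ localSubgroup κ.kerSubgroup (v.adicCompletion ℚ), h • t = t → h • w = w) ∧
      (∃ jw : ℤ, τ₀ • w * w = Q ^ jw) ∧ x = Q ^ c' * (g • w / w) := by
  have hile : localSubgroup κ.kerSubgroup (v.adicCompletion ℚ) ≤ localSubgroup (κ.layerSubgroup n) (v.adicCompletion ℚ) :=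
    fun τ hτ ↦ by
      rw [mem_localSubgroup_iff] at hτ ⊢
      exact κ.kerSubgroup_le_layerSubgroup n hτ
  -- normalise to the unit circle: `x' = x / Q^c`
  obtain ⟨hx'L, hx'U, hx'2⟩ := smul_mul_zpow_inv (κ := κ) v hQfix hQ0 hxL hxc hx2
  obtain ⟨y, hy0, hyL, hxy, hv0, hvn⟩ :=
    exists_coboundary_of_sq_eq (κ := κ) v n hug ht hgt hτ₀ hτ₀t hQfix hQ0 hQtor hx'L hx'U hz0 hzL hzj hx'2
  -- the class field axiom on `{y·τ₀y, 1, Q}`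
  have h1fix : ∀ h ∈ localSubgroup (κ.layerSubgroup n) (v.adicCompletion ℚ), h • (1 : AlgebraicClosure (v.adicCompletion ℚ)) = 1 :=
    fun h _ ↦ smul_one h
  obtain ⟨f₀, hf₀0, hf₀M, hcases⟩ := hN2 (y * τ₀ • y) 1 Q hv0 one_ne_zero hQ0 hvn h1fix (fun h _ ↦ hQfix h)
  have hτf₀0 : τ₀ • f₀ ≠ 0 := (smul_ne_zero_iff_ne τ₀).mpr hf₀0
  -- `1 = N(f₀) Q` is case A for `f₀⁻¹`: excluded
  have hnot : ¬ (1 : AlgebraicClosure (v.adicCompletion ℚ)) = f₀ * τ₀ • f₀ * Q := by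
    intro h
    refine hB f₀⁻¹ (inv_ne_zero hf₀0) (fun h' hh hht ↦ by rw [smul_inv'', hf₀M h' hh hht]) ?_
    rw [smul_inv'']
    field_simp
    linear_combination h
  have hrel : ∃ ε : ℤ, y * τ₀ • y = Q ^ ε * (f₀ * τ₀ • f₀) * (1 * τ₀ • (1 : AlgebraicClosure (v.adicCompletion ℚ))) := by
    rw [smul_one, mul_one]
    rcases hcases with h | h | h
    · exact ⟨0, by rw [h, zpow_zero, one_mul, mul_one]⟩
    · exact ⟨1, by rw [h, zpow_one]; ring⟩
    · exact (hnot h).elim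
  obtain ⟨ε, hε⟩ := hrel
  obtain ⟨hw0, hwL, hwε, hww⟩ := div_coboundary_eq_of_norm_rel (κ := κ) v n hgn hgt hy0 one_ne_zero hf₀0 hyL
    (fun h _ _ ↦ smul_one h) hf₀M hε
  refine ⟨c, y / (1 * f₀), hw0, hwL, ⟨ε, hwε⟩, ?_⟩
  rw [← hww, smul_one, div_one, div_one, ← hxy]
  field_simp


/-- **MAIN: no three pairwise distinct `2`-torsion coinvariant classes.** In the setting of BRICKs 15/16 (non-split Tate
unit `q = 2^k u`, `u ≡ 3, 5 (mod 8)`; `g` a topological generator of `H_n` modulo `H_∞` fixing `t`; `τ₀ ∈ H_∞` a flip;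
`hN2` the class field axiom for the quadratic layer `K̄^{H_n ∩ Stab(t)}/F_n` in «three elements, two congruent» form):
among any three `x₀, x₁, x₂ ∈ T` whose squares lie in `B = q^ℤ·(g−1)T`, two are congruent modulo `B`. CASE A (some
`f₀` with `N_σ f₀ = q`): all exponents are even (BRICK 16c), normalise, write `x_i' = gy_i/y_i` (BRICK 16b), apply `hN2`
to the three norms `y_i·τ₀y_i` and conclude by C7. CASE B: two exponents have the same parity and C6 applies to the
quotient. [cite: GreenbergLNM1716, §3 (pp. 87–93)] -/
theorem exists_div_eq_zpow_mul_coboundary_of_three (hκ : κ.IsCyclotomic) (v : HeightOneSpectrum (𝓞 ℚ))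
    (hv : ((2 : ℕ) : 𝓞 ℚ) ∈ v.asIdeal) (n : ℕ) {g : absoluteGaloisGroup (v.adicCompletion ℚ)} {ug : ℤ_[2]ˣ}
    (hug : ((κ (resGal (K := ℚ) (v.adicCompletion ℚ) g)).toAdd : ℤ_[2]) = 2 ^ n * (ug : ℤ_[2]))
    (hgn : g ∈ localSubgroup (κ.layerSubgroup n) (v.adicCompletion ℚ))
    {t : AlgebraicClosure (v.adicCompletion ℚ)}
    (ht : ∀ σ : absoluteGaloisGroup (v.adicCompletion ℚ), σ • t = t ∨ σ • t = -t) (ht0 : t ≠ 0) (hgt : g • t = t)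
    {τ₀ : absoluteGaloisGroup (v.adicCompletion ℚ)} (hτ₀ : τ₀ ∈ localSubgroup κ.kerSubgroup (v.adicCompletion ℚ))
    (hτ₀t : τ₀ • t = -t) (p : ℕ) [Fact p.Prime] (hp : p = 2) (e : v.adicCompletion ℚ ≃+* ℚ_[p])
    {q : v.adicCompletion ℚ} (hq0 : q ≠ 0) {k : ℕ} {u : ℤ_[p]} (hq : e q = (p : ℚ_[p]) ^ k * (u : ℚ_[p]))
    (hu : toZModPow 3 u = 3 ∨ toZModPow 3 u = 5)
    (hQtor : ∀ j : ℤ, algebraMap (v.adicCompletion ℚ) (AlgebraicClosure (v.adicCompletion ℚ)) q ^ j = 1 → j = 0)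
    (hN2 : ∀ c₁ c₂ c₃ : AlgebraicClosure (v.adicCompletion ℚ), c₁ ≠ 0 → c₂ ≠ 0 → c₃ ≠ 0 →
      (∀ h ∈ localSubgroup (κ.layerSubgroup n) (v.adicCompletion ℚ), h • c₁ = c₁) →
      (∀ h ∈ localSubgroup (κ.layerSubgroup n) (v.adicCompletion ℚ), h • c₂ = c₂) →
      (∀ h ∈ localSubgroup (κ.layerSubgroup n) (v.adicCompletion ℚ), h • c₃ = c₃) →
      ∃ f₀ : AlgebraicClosure (v.adicCompletion ℚ), f₀ ≠ 0 ∧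
        (∀ h ∈ localSubgroup (κ.layerSubgroup n) (v.adicCompletion ℚ), h • t = t → h • f₀ = f₀) ∧
        (c₁ = f₀ * τ₀ • f₀ * c₂ ∨ c₁ = f₀ * τ₀ • f₀ * c₃ ∨ c₂ = f₀ * τ₀ • f₀ * c₃))
    {x z : Fin 3 → AlgebraicClosure (v.adicCompletion ℚ)} {a j jz : Fin 3 → ℤ} (hx0 : ∀ i, x i ≠ 0)
    (hxL : ∀ i, ∀ h ∈ localSubgroup κ.kerSubgroup (v.adicCompletion ℚ), h • t = t → h • x i = x i)
    (hxa : ∀ i, τ₀ • x i * x i = algebraMap (v.adicCompletion ℚ) (AlgebraicClosure (v.adicCompletion ℚ)) q ^ a i)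
    (hz0 : ∀ i, z i ≠ 0)
    (hzL : ∀ i, ∀ h ∈ localSubgroup κ.kerSubgroup (v.adicCompletion ℚ), h • t = t → h • z i = z i)
    (hzj : ∀ i, τ₀ • z i * z i = algebraMap (v.adicCompletion ℚ) (AlgebraicClosure (v.adicCompletion ℚ)) q ^ jz i)
    (hx2 : ∀ i, x i ^ 2 =
      algebraMap (v.adicCompletion ℚ) (AlgebraicClosure (v.adicCompletion ℚ)) q ^ j i * (g • z i / z i)) :
    ∃ i i' : Fin 3, i ≠ i' ∧ ∃ (c : ℤ) (w : AlgebraicClosure (v.adicCompletion ℚ)), w ≠ 0 ∧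
      (∀ h ∈ localSubgroup κ.kerSubgroup (v.adicCompletion ℚ), h • t = t → h • w = w) ∧
      (∃ jw : ℤ, τ₀ • w * w = algebraMap (v.adicCompletion ℚ) (AlgebraicClosure (v.adicCompletion ℚ)) q ^ jw) ∧
      x i / x i' = algebraMap (v.adicCompletion ℚ) (AlgebraicClosure (v.adicCompletion ℚ)) q ^ c * (g • w / w) := by
  set Q : AlgebraicClosure (v.adicCompletion ℚ) := algebraMap (v.adicCompletion ℚ) (AlgebraicClosure (v.adicCompletion ℚ)) q
    with hQ
  have hQ0 : Q ≠ 0 := by rw [hQ]; exact (map_ne_zero _).mpr hq0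
  have hQfix : ∀ σ : absoluteGaloisGroup (v.adicCompletion ℚ), σ • Q = Q := fun σ ↦
    AlgEquiv.commutes (absoluteGaloisGroup.toAlgEquiv _ σ) q
  by_cases hA : ∃ f₀ : AlgebraicClosure (v.adicCompletion ℚ), f₀ ≠ 0 ∧
      (∀ h ∈ localSubgroup (κ.layerSubgroup n) (v.adicCompletion ℚ), h • t = t → h • f₀ = f₀) ∧ τ₀ • f₀ * f₀ = Q
  · -- CASE A: every exponent is even (BRICK 16c)
    obtain ⟨f₀, hf₀0, hf₀M, hf₀N⟩ := hA
    have heven : ∀ i, ∃ c : ℤ, τ₀ • x i * x i = Q ^ (2 * c) := fun i ↦ by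
      obtain ⟨r, hr | hr⟩ := Int.even_or_odd' (a i)
      · exact ⟨r, by rw [hxa i, hr]⟩
      · exact (false_of_odd_exponent_of_sq_eq hκ v hv n hug hgn ht ht0 hgt hτ₀ hτ₀t p hp e hq0 hq hu hQtor hf₀0 hf₀M
          hf₀N (hx0 i) (hxL i) ⟨r, hr⟩ (hxa i) (hz0 i) (hzL i) (hzj i) (hx2 i)).elim
    choose c hc using heven
    -- normalise and write each `x_i Q^{-c_i}` as a coboundary `g y_i / y_i` (BRICK 16b)
    have hcob : ∀ i, ∃ y : AlgebraicClosure (v.adicCompletion ℚ), y ≠ 0 ∧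
        (∀ h ∈ localSubgroup κ.kerSubgroup (v.adicCompletion ℚ), h • t = t → h • y = y) ∧
        x i * (Q ^ c i)⁻¹ = g • y / y ∧ y * τ₀ • y ≠ 0 ∧
        ∀ h ∈ localSubgroup (κ.layerSubgroup n) (v.adicCompletion ℚ), h • (y * τ₀ • y) = y * τ₀ • y := fun i ↦ by
      obtain ⟨hx'L, hx'U, hx'2⟩ := smul_mul_zpow_inv (κ := κ) v hQfix hQ0 (hxL i) (hc i) (hx2 i)
      exact exists_coboundary_of_sq_eq (κ := κ) v n hug ht hgt hτ₀ hτ₀t hQfix hQ0 hQtor hx'L hx'U (hz0 i) (hzL i)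
        (hzj i) hx'2
    choose y hy0 hyL hxy hN0 hNn using hcob
    -- the class field axiom on the three norms
    obtain ⟨f, hf0, hfM, hcases⟩ := hN2 (y 0 * τ₀ • y 0) (y 1 * τ₀ • y 1) (y 2 * τ₀ • y 2) (hN0 0) (hN0 1) (hN0 2)
      (hNn 0) (hNn 1) (hNn 2)
    obtain ⟨i, i', hii', hrel⟩ : ∃ i i' : Fin 3, i ≠ i' ∧ y i * τ₀ • y i = f * τ₀ • f * (y i' * τ₀ • y i') := by
      rcases hcases with h | h | h
      exacts [⟨0, 1, by decide, h⟩, ⟨0, 2, by decide, h⟩, ⟨1, 2, by decide, h⟩]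
    have hrel' : y i * τ₀ • y i = Q ^ (0 : ℤ) * (f * τ₀ • f) * (y i' * τ₀ • y i') := by
      rw [zpow_zero, one_mul]; exact hrel
    -- C7
    obtain ⟨hw0, hwL, hwε, hww⟩ :=
      div_coboundary_eq_of_norm_rel (κ := κ) v n hgn hgt (hy0 i) (hy0 i') hf0 (hyL i) (hyL i') hfM hrel'
    refine ⟨i, i', hii', c i - c i', y i / (y i' * f), hw0, hwL, ⟨0, hwε⟩, ?_⟩
    have hQci : Q ^ c i ≠ 0 := zpow_ne_zero _ hQ0
    have hQci' : Q ^ c i' ≠ 0 := zpow_ne_zero _ hQ0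
    have hxi' := hx0 i'
    rw [← hww, ← hxy i, ← hxy i', zpow_sub₀ hQ0]
    field_simp
  · -- CASE B: two exponents have the same parity, and C6 applies to the quotient
    push Not at hA
    obtain ⟨i, i', hii', c, hc⟩ : ∃ i i' : Fin 3, i ≠ i' ∧ ∃ c : ℤ, a i - a i' = 2 * c := by
      obtain ⟨r0, h0⟩ := Int.even_or_odd' (a 0)
      obtain ⟨r1, h1⟩ := Int.even_or_odd' (a 1)
      obtain ⟨r2, h2⟩ := Int.even_or_odd' (a 2)
      rcases h0 with h0 | h0 <;> rcases h1 with h1 | h1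
      · exact ⟨0, 1, by decide, r0 - r1, by omega⟩
      · rcases h2 with h2 | h2
        · exact ⟨0, 2, by decide, r0 - r2, by omega⟩
        · exact ⟨1, 2, by decide, r1 - r2, by omega⟩
      · rcases h2 with h2 | h2
        · exact ⟨1, 2, by decide, r1 - r2, by omega⟩
        · exact ⟨0, 2, by decide, r0 - r2, by omega⟩
      · exact ⟨0, 1, by decide, r0 - r1, by omega⟩
    have hτxi' : τ₀ • x i' * x i' ≠ 0 := by rw [hxa i']; exact zpow_ne_zero _ hQ0
    have hτzi' : τ₀ • z i' * z i' ≠ 0 := by rw [hzj i']; exact zpow_ne_zero _ hQ0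
    have hτx0 : τ₀ • x i' ≠ 0 := (smul_ne_zero_iff_ne τ₀).mpr (hx0 i')
    have hτz0 : τ₀ • z i' ≠ 0 := (smul_ne_zero_iff_ne τ₀).mpr (hz0 i')
    have hgz0 : g • z i' ≠ 0 := (smul_ne_zero_iff_ne g).mpr (hz0 i')
    have hX0 : x i / x i' ≠ 0 := div_ne_zero (hx0 i) (hx0 i')
    have hXL : ∀ h ∈ localSubgroup κ.kerSubgroup (v.adicCompletion ℚ), h • t = t → h • (x i / x i') = x i / x i' :=
      fun h hh hht ↦ by rw [smul_div₀', hxL i h hh hht, hxL i' h hh hht]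
    have hXc : τ₀ • (x i / x i') * (x i / x i') = Q ^ (2 * c) := by
      rw [← hc, zpow_sub₀ hQ0, ← hxa i, ← hxa i', smul_div₀']
      field_simp
    have hZ0 : z i / z i' ≠ 0 := div_ne_zero (hz0 i) (hz0 i')
    have hZL : ∀ h ∈ localSubgroup κ.kerSubgroup (v.adicCompletion ℚ), h • t = t → h • (z i / z i') = z i / z i' :=
      fun h hh hht ↦ by rw [smul_div₀', hzL i h hh hht, hzL i' h hh hht]
    have hZj : τ₀ • (z i / z i') * (z i / z i') = Q ^ (jz i - jz i') := by
      rw [zpow_sub₀ hQ0, ← hzj i, ← hzj i', smul_div₀']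
      field_simp
    have hX2 : (x i / x i') ^ 2 = Q ^ (j i - j i') * (g • (z i / z i') / (z i / z i')) := by
      rw [div_pow, hx2 i, hx2 i', zpow_sub₀ hQ0, smul_div₀']
      field_simp
    obtain ⟨c', w, hw0, hwL, hwj, hxw⟩ := exists_eq_zpow_mul_coboundary_of_even (κ := κ) v n hug hgn ht hgt hτ₀ hτ₀t
      hQfix hQ0 hQtor hA hN2 hX0 hXL hXc hZ0 hZL hZj hX2
    exact ⟨i, i', hii', c', w, hw0, hwL, hwj, hxw⟩

end Summit.BirchSwinnertonDyer.BirchSwinnertonDyer.Theorems.MultTowerNS2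

end
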